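import Mathlib
import HarnessLib

/-!
# Local updates on a general state space: fibrewise-reversible kernels lift, and the single-site heat bath is exact

HONEST FRAMING: exact (Metropolis-corrected) sampling algorithms for lattice gauge theory;
figures of merit are autocorrelation/cost numbers at stated couplings and volumes; no
continuum-physics claim.

Venture `LatticeQCDFlow` (cell pub-lqcd), topic `Exactness`, FANOUT row 9 (eng-latcore, the
engine `latflow.core`).  NEW WORK of the cell over Mathlib's Markov-kernel library; nothing here
is cited as a fact.  Printed counterparts, named only: Geman–Geman 1984 (Gibbs sampler), Creutz
1980 / Kennedy–Pendleton 1985 / Cabibbo–Marinari 1982 (SU(2) heat bath and SU(N) by subgroups),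
Tierney 1998 §2.

`LocalUpdates.lean` / `HeatBath.lean` (rows 30 / 9) type the FINITE-state block update: touch one
coordinate `x` with a rule that may read the frozen rest `y`; detailed balance in every fibre
gives detailed balance for the joint weight.  The engine's updates live on CONTINUOUS groups
(`G^E` with Haar measure).  This file is the general-state-space version over Mathlib `Kernel`s,
and its first instance, the exact conditional redraw (heat bath).

## Content (`X` = the updated coordinate, `Y` = everything frozen; reference `μ ⊗ ν`; joint density `p : X × Y → ℝ≥0∞`)

* `freezeSnd κ` — lift an `X`-update `κ : Kernel (X × Y) X` (it may read `y`) to the kernel on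
  `X × Y` that moves `x` and keeps `y`: `κ ×ₖ (deterministic Prod.snd)`; `freezeSnd_apply`:
  `K (x, y) B = κ (x, y) {x' | (x', y) ∈ B}`; `fibre κ y : Kernel X X` — the update at frozen `y`.
* `freezeSnd_isReversible` — **if every fibre `fibre κ y` is reversible for the conditional weight
  `p(·, y) · μ`, then `freezeSnd κ` is reversible for the joint `p · (μ ⊗ ν)`** (Mathlib
  `Kernel.IsReversible`; Tonelli puts `y` outermost, the `A`/`B` sections are the fibre's sets).
  Every single-link update of the engine is used through this lemma: heat bath (below),
  over-relaxation (`Overrelaxation.lean`), the Metropolis hit (`SymmetricMetropolis.lean`) and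
  HMC on a sub-block (`SplittingIntegrator.lean`) are fibrewise-reversible families.
* The **heat bath**: `condNorm μ p y = ∫ p(x, y) μ(dx)`, `heatBathX μ p` = redraw `x'` with density
  `p(x', y) / condNorm y` against `μ`, whatever the current `x`; `heatBathX_apply`;
  `fibre_heatBathX_isReversible` — in each fibre the flow `A → B` is
  `π_y(A) π_y(B) / Z(y)`, symmetric; **`heatBath_isReversible`** — the lifted heat bath is
  reversible for `p · (μ ⊗ ν)` for every measurable `p` with `p < ∞` and `Z(y) ≠ 0` (the
  s-finiteness side conditions of `Kernel.withDensity`); `isMarkovKernel_heatBath` — it is a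
  Markov kernel when moreover `Z(y) < ∞`.  For the Wilson action this is the Creutz /
  Kennedy–Pendleton link heat bath (`X = SU(2)`, `μ` = Haar, `p(U, rest) = e^{β/2 Re tr (U R†)} ×
  (rest)`), and — composed over SU(2) subgroups, `PartitionHeatBath.lean` — Cabibbo–Marinari.

Not here: how the engine SAMPLES the SU(2) conditional (Kennedy–Pendleton rejection; acceptance
test A3 checks the sampled density against `√(1−a₀²) e^{β k a₀}` by χ²), ergodicity, sweeps
(`SequentialScanAdjoint.lean`).
-/

namespace Summit.Ventures.LatticeQCDFlow.Exactness

open MeasureTheory ProbabilityTheory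
open scoped ENNReal

variable {X Y : Type*} [MeasurableSpace X] [MeasurableSpace Y]

/-! ## §1 Freezing a coordinate: fibrewise reversibility lifts -/

/-- Lift an `X`-update that may read the frozen coordinate to a kernel on `X × Y` keeping `y`:
`(x, y) ↦ (x', y)` with `x' ∼ κ (x, y)`. -/
noncomputable def freezeSnd (κ : Kernel (X × Y) X) : Kernel (X × Y) (X × Y) :=
  κ ×ₖ Kernel.deterministic Prod.snd measurable_snd

/-- The update at frozen `y`, as a kernel on `X` alone. -/
noncomputable def fibre (κ : Kernel (X × Y) X) (y : Y) : Kernel X X :=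
  Kernel.comap κ (fun x => (x, y)) measurable_prodMk_right

/-- Pointwise formula for the fibre kernel. -/
@[simp] theorem fibre_apply (κ : Kernel (X × Y) X) (y : Y) (x : X) : fibre κ y x = κ (x, y) := rfl

/-- The lifted kernel is Markov when the update is. -/
instance instIsMarkovKernelFreezeSnd (κ : Kernel (X × Y) X) [IsMarkovKernel κ] :
    IsMarkovKernel (freezeSnd κ) := by
  unfold freezeSnd; infer_instance

/-- Set-wise formula: `K (x, y) B = κ (x, y) {x' | (x', y) ∈ B}` — the mass a lifted update gives
to `B` is the mass its `X`-law gives to the `y`-section of `B`. -/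
theorem freezeSnd_apply (κ : Kernel (X × Y) X) [IsSFiniteKernel κ] (z : X × Y) {B : Set (X × Y)}
    (hB : MeasurableSet B) : freezeSnd κ z B = κ z ((fun x' => (x', z.2)) ⁻¹' B) := by
  rw [freezeSnd, Kernel.prod_apply' _ _ _ hB, ← lintegral_indicator_one (measurable_prodMk_right hB)]
  refine lintegral_congr fun b => ?_
  rw [Kernel.deterministic_apply, Measure.dirac_apply' _ (measurable_prodMk_left hB)]
  by_cases hb : (b, z.2) ∈ B
  · rw [Set.indicator_of_mem (show z.2 ∈ Prod.mk b ⁻¹' B from hb),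
      Set.indicator_of_mem (show b ∈ (fun x' => (x', z.2)) ⁻¹' B from hb), Pi.one_apply, Pi.one_apply]
  · rw [Set.indicator_of_notMem (show z.2 ∉ Prod.mk b ⁻¹' B from hb),
      Set.indicator_of_notMem (show b ∉ (fun x' => (x', z.2)) ⁻¹' B from hb)]

/-- The mass flow of a lifted update against the joint weight, as an outer `ν(dy)`-integral of the
FIBRE flows between the `y`-sections `A_y = {x | (x, y) ∈ A}` and `B_y`. -/
theorem setLIntegral_freezeSnd {μ : Measure X} {ν : Measure Y} [SFinite μ] [SFinite ν]
    (κ : Kernel (X × Y) X) [IsSFiniteKernel κ] {p : X × Y → ℝ≥0∞} (hp : Measurable p)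
    {A B : Set (X × Y)} (hA : MeasurableSet A) (hB : MeasurableSet B) :
    ∫⁻ z in A, freezeSnd κ z B ∂((μ.prod ν).withDensity p) =
      ∫⁻ y, ∫⁻ x in (fun x => (x, y)) ⁻¹' A, fibre κ y x ((fun x => (x, y)) ⁻¹' B)
        ∂(μ.withDensity fun x => p (x, y)) ∂ν := by
  have hK : Measurable fun z => freezeSnd κ z B := Kernel.measurable_coe _ hB
  rw [setLIntegral_withDensity_eq_setLIntegral_mul _ hp hK hA, ← lintegral_indicator hA,
    lintegral_prod_symm _ ((hp.mul hK).indicator hA).aemeasurable]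
  refine lintegral_congr fun y => ?_
  have hAy : MeasurableSet ((fun x => (x, y)) ⁻¹' A) := measurable_prodMk_right hA
  have hBy : MeasurableSet ((fun x => (x, y)) ⁻¹' B) := measurable_prodMk_right hB
  have hKy : Measurable fun x => fibre κ y x ((fun x => (x, y)) ⁻¹' B) :=
    Kernel.measurable_coe _ hBy
  have hpy : Measurable fun x => p (x, y) := hp.comp measurable_prodMk_right
  rw [setLIntegral_withDensity_eq_setLIntegral_mul _ hpy hKy hAy, ← lintegral_indicator hAy]
  refine lintegral_congr fun x => ?_
  by_cases hxy : (x, y) ∈ A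
  · rw [Set.indicator_of_mem hxy, Set.indicator_of_mem (show x ∈ (fun x => (x, y)) ⁻¹' A from hxy),
      Pi.mul_apply, Pi.mul_apply, fibre_apply, freezeSnd_apply _ _ hB]
  · rw [Set.indicator_of_notMem hxy, Set.indicator_of_notMem (show x ∉ (fun x => (x, y)) ⁻¹' A from hxy)]

/-- **Fibrewise reversibility lifts.**  If for every frozen `y` the `X`-update `fibre κ y` is
reversible with respect to the conditional weight `p(·, y) · μ`, then the lifted update
`freezeSnd κ` is reversible with respect to the joint weight `p · (μ ⊗ ν)` — the general-state
form of "detailed balance in each block gives detailed balance" behind every local update. -/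
theorem freezeSnd_isReversible {μ : Measure X} {ν : Measure Y} [SFinite μ] [SFinite ν]
    (κ : Kernel (X × Y) X) [IsSFiniteKernel κ] {p : X × Y → ℝ≥0∞} (hp : Measurable p)
    (hfib : ∀ y, Kernel.IsReversible (fibre κ y) (μ.withDensity fun x => p (x, y))) :
    Kernel.IsReversible (freezeSnd κ) ((μ.prod ν).withDensity p) := by
  intro A B hA hB
  rw [setLIntegral_freezeSnd κ hp hA hB, setLIntegral_freezeSnd κ hp hB hA]
  refine lintegral_congr fun y => ?_
  exact hfib y (measurable_prodMk_right hA) (measurable_prodMk_right hB)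

/-- … hence the joint weight is invariant under the lifted update (Markov case). -/
theorem freezeSnd_invariant {μ : Measure X} {ν : Measure Y} [SFinite μ] [SFinite ν]
    (κ : Kernel (X × Y) X) [IsMarkovKernel κ] {p : X × Y → ℝ≥0∞} (hp : Measurable p)
    (hfib : ∀ y, Kernel.IsReversible (fibre κ y) (μ.withDensity fun x => p (x, y))) :
    Kernel.Invariant (freezeSnd κ) ((μ.prod ν).withDensity p) :=
  (freezeSnd_isReversible κ hp hfib).invariant

/-! ## §2 The heat bath: exact redraw of one coordinate from its conditional law -/

section HeatBath

variable (μ : Measure X) [SFinite μ] (p : X × Y → ℝ≥0∞)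

/-- The conditional normaliser `Z(y) = ∫ p(x, y) μ(dx)`. -/
noncomputable def condNorm (y : Y) : ℝ≥0∞ := ∫⁻ x, p (x, y) ∂μ

/-- **Heat-bath `X`-update**: redraw `x'` with density `p(x', y) / Z(y)` against `μ`, reading the
frozen `y` and ignoring the current `x`. -/
noncomputable def heatBathX : Kernel (X × Y) X :=
  Kernel.withDensity (Kernel.const (X × Y) μ) (fun z x' => p (x', z.2) * (condNorm μ p z.2)⁻¹)

variable {μ p}

/-- Measurability of the conditional normaliser. -/
theorem measurable_condNorm (hp : Measurable p) : Measurable (condNorm μ p) :=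
  hp.lintegral_prod_left'

/-- Measurability of the heat-bath density `(z, x') ↦ p(x', z.2) / Z(z.2)`. -/
theorem measurable_heatBathDensity (hp : Measurable p) :
    Measurable (Function.uncurry fun (z : X × Y) (x' : X) => p (x', z.2) * (condNorm μ p z.2)⁻¹) :=
  (hp.comp (measurable_snd.prodMk (measurable_snd.comp measurable_fst))).mul
    ((measurable_condNorm hp).comp (measurable_snd.comp measurable_fst)).inv

/-- The heat-bath update is an s-finite kernel when `p < ∞` and no conditional normaliser
vanishes (the side conditions of `Kernel.withDensity`). -/
theorem isSFiniteKernel_heatBathX (hp_top : ∀ z, p z ≠ ∞)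
    (hZ : ∀ y, condNorm μ p y ≠ 0) : IsSFiniteKernel (heatBathX μ p) :=
  Kernel.IsSFiniteKernel.withDensity _
    (fun z x' => ENNReal.mul_ne_top (hp_top (x', z.2)) (ENNReal.inv_ne_top.mpr (hZ z.2)))

/-- Set-wise formula: `heatBathX (x, y) t = ∫_t p(x', y) / Z(y) μ(dx')` (independent of `x`). -/
theorem heatBathX_apply (hp : Measurable p) (z : X × Y) {t : Set X} :
    heatBathX μ p z t = ∫⁻ x' in t, p (x', z.2) * (condNorm μ p z.2)⁻¹ ∂μ := by
  rw [heatBathX, Kernel.withDensity_apply' _ (measurable_heatBathDensity hp), Kernel.const_apply]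

/-- **In every fibre the heat bath is reversible** for the conditional weight `p(·, y) · μ`: the
flow `A → B` equals `π_y(A) π_y(B) / Z(y)`, symmetric in `A`, `B`. -/
theorem fibre_heatBathX_isReversible (hp : Measurable p) (y : Y) :
    Kernel.IsReversible (fibre (heatBathX μ p) y) (μ.withDensity fun x => p (x, y)) := by
  intro s t hs ht
  have happly : ∀ (u : Set X) (x : X), fibre (heatBathX μ p) y x u =
      (∫⁻ x' in u, p (x', y) ∂μ) * (condNorm μ p y)⁻¹ := fun u x => by
    rw [fibre_apply, heatBathX_apply hp]
    exact lintegral_mul_const _ (hp.comp measurable_prodMk_right)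
  simp_rw [happly t, happly s]
  rw [setLIntegral_const, setLIntegral_const, withDensity_apply _ hs, withDensity_apply _ ht]
  ring

/-- **The heat bath is exact.**  For every measurable joint density `p < ∞` with non-vanishing
conditional normalisers, redrawing one coordinate from its conditional law — whatever the
current value — is reversible with respect to `p · (μ ⊗ ν)`. -/
theorem heatBath_isReversible {ν : Measure Y} [SFinite ν] (hp : Measurable p)
    (hp_top : ∀ z, p z ≠ ∞) (hZ : ∀ y, condNorm μ p y ≠ 0) :
    Kernel.IsReversible (freezeSnd (heatBathX μ p)) ((μ.prod ν).withDensity p) := by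
  haveI := isSFiniteKernel_heatBathX hp_top hZ
  exact freezeSnd_isReversible _ hp (fibre_heatBathX_isReversible hp)

/-- The heat bath is a Markov kernel when every conditional normaliser is finite and non-zero. -/
theorem isMarkovKernel_heatBath (hp : Measurable p) (hp_top : ∀ z, p z ≠ ∞)
    (hZ : ∀ y, condNorm μ p y ≠ 0) (hZtop : ∀ y, condNorm μ p y ≠ ∞) :
    IsMarkovKernel (freezeSnd (heatBathX μ p)) := by
  haveI := isSFiniteKernel_heatBathX hp_top hZ
  refine ⟨fun z => ⟨?_⟩⟩
  have hpz : Measurable fun x' => p (x', z.2) := hp.comp measurable_prodMk_right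
  rw [freezeSnd_apply _ _ MeasurableSet.univ, Set.preimage_univ, heatBathX_apply hp,
    Measure.restrict_univ, lintegral_mul_const _ hpz]
  exact ENNReal.mul_inv_cancel (hZ z.2) (hZtop z.2)

/-- … and then `p · (μ ⊗ ν)` is invariant under the heat bath. -/
theorem heatBath_invariant {ν : Measure Y} [SFinite ν] (hp : Measurable p)
    (hp_top : ∀ z, p z ≠ ∞) (hZ : ∀ y, condNorm μ p y ≠ 0) (hZtop : ∀ y, condNorm μ p y ≠ ∞) :
    Kernel.Invariant (freezeSnd (heatBathX μ p)) ((μ.prod ν).withDensity p) := by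
  haveI := isMarkovKernel_heatBath hp hp_top hZ hZtop
  exact (heatBath_isReversible hp hp_top hZ).invariant

end HeatBath

end Summit.Ventures.LatticeQCDFlow.Exactness
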